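import Summits.CriticalPhenomena.PercolationContinuityZ3.Theorems.PercNearOneGluingAdditiveGluingFingerLeaves
import HarnessLib

/-! # Crux `PercNearOneGluing.AdditiveGluing` (stmt-CriticalPhenomena-4576) — the finger multi-edge Lemma 3 (`stub_fingerML3_vp`):
# peeling a LIST of finger–relay pairs (seat (b) V⁺-form, `png-dp-vplus`, gen 8)

Support file (`--supports stmt-CriticalPhenomena-4576`); no definitions, no named facts, no sorries.  Packaging of the one-pair steps
`fingerML3_peel_pair` (gen 6) and `fingerML3_peel_pair_self` (gen 8) into a many-pair reduction.

Setting of `stub_fingerML3_vp`: weighting `K` on `Fin n`, relays `A ∋ b, d`, block `N` disjoint from `A`, glued weighting `g = K/N`,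
`R` = "some pair `N–A` open", conclusion FML3(K): `μ_g(R ∩ {d↔b}) ≤ μ_g(R ∩ ⋃_{v∈N}{v↔b})`.

* `fingerML3_peel_list` — given a list `ps = [(f₁,a₁), …, (f_k,a_k)]` of finger–relay pairs (`f_i ∈ N`, `a_i ∈ A`), write
  `K_i` = `K` with the pairs `s(f₁,a₁), …, s(f_i,a_i)` killed.  If at every stage the comparison vertex is below the next relay in the
  CURRENT weighting, `μ_{K_{i-1}}(d↔b) ≤ μ_{K_{i-1}}(a_i↔b)` (nothing is asked when `a_i = d`), and FML3(`K_k`) holds, then FML3(`K`) holds.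
  (Induction on the list; each step is `fingerML3_peel_pair` — Kozma–Nitzan Lemma 3(ii) at `a_i` + restricted Lemma 3(i) — or
  `fingerML3_peel_pair_self`.)
Use (memo MEMO-gen8 §4, run/shared/lean/prim/prim-png-dp-vplus/): FINGER STRIPPING — kill all hairs of one finger `f` in an order along which
`d` stays below the relay being detached, then recurse on the system without `f` (whose hypothesis must be re-checked); on the depth prover's
random "open core" (≥ 3 contact relays, ≥ 2 multi-contact fingers, `d` not base-minimal, no leaves) such an order exists in ≈ 85 % of the
hypothesis-satisfying instances (lab/s13.py: 491/577), and the leaf case (`…FingerLeavesStrip.lean`) is the one where the re-check is automatic.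
[cite: KozmaNitzan2024, Lemma 3(i)–(ii) (pp. 6–7), §3.2 pp. 12–14]
-/

namespace Summit.CriticalPhenomena.PercolationContinuityZ3.Theorems

open MeasureTheory Set
open Literature.Probability.LatticeModels (prodBernoulli)
open Literature.Probability.Percolation (BondConfig openConn openGraph pinW)

noncomputable section
open Classical

section FingerPeelList

open Literature.Probability.LatticeModels Literature.Probability.Percolation

variable {n : ℕ}

/-- Killing the pairs of `p :: qs` is killing `s(p.1,p.2)` and then the pairs of `qs` (pointwise form). [folklore] -/
theorem killPairs_cons_apply (K : Sym2 (Fin n) → unitInterval) (p : Fin n × Fin n) (qs : List (Fin n × Fin n)) (e : Sym2 (Fin n)) :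
    (if e ∈ (p :: qs).map (fun q : Fin n × Fin n => s(q.1, q.2)) then (0 : unitInterval) else K e) =
      (if e ∈ qs.map (fun q : Fin n × Fin n => s(q.1, q.2)) then (0 : unitInterval) else
        (if e = s(p.1, p.2) then (0 : unitInterval) else K e)) := by
  by_cases hq : e ∈ qs.map (fun q : Fin n × Fin n => s(q.1, q.2))
  · have h1 : e ∈ (p :: qs).map (fun q : Fin n × Fin n => s(q.1, q.2)) := by
      rw [List.map_cons, List.mem_cons]
      exact Or.inr hq
    rw [if_pos h1, if_pos hq]
  · by_cases hp : e = s(p.1, p.2)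
    · have h1 : e ∈ (p :: qs).map (fun q : Fin n × Fin n => s(q.1, q.2)) := by
        rw [List.map_cons, List.mem_cons]
        exact Or.inl hp
      rw [if_pos h1, if_neg hq, if_pos hp]
    · have h1 : e ∉ (p :: qs).map (fun q : Fin n × Fin n => s(q.1, q.2)) := by
        rw [List.map_cons, List.mem_cons]
        rintro (h | h)
        · exact hp h
        · exact hq h
      rw [if_neg h1, if_neg hq, if_neg hp]

/-- Killing the pairs of the empty list changes nothing (pointwise form). [folklore] -/
theorem killPairs_nil_apply (K : Sym2 (Fin n) → unitInterval) (e : Sym2 (Fin n)) :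
    (if e ∈ ([] : List (Fin n × Fin n)).map (fun q : Fin n × Fin n => s(q.1, q.2)) then (0 : unitInterval) else K e) = K e := by
  rw [List.map_nil, if_neg List.not_mem_nil]

/-- **Peeling a list of finger–relay pairs.**  Stub setting (`d ∈ A`, `Disjoint N A`); `ps` a list of pairs `(f_i, a_i)` with `f_i ∈ N`,
`a_i ∈ A`; `K_i` = `K` with the first `i` pairs killed.  If `μ_{K_{i}}(d↔b) ≤ μ_{K_{i}}(a_{i+1}↔b)` whenever `a_{i+1} ≠ d`, and the
conclusion of `stub_fingerML3_vp` holds for `K_k` (all pairs of `ps` killed), then it holds for `K`.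
[cite: KozmaNitzan2024, Lemma 3(i)–(ii) (pp. 6–7), §3.2 pp. 12–14] -/
theorem fingerML3_peel_list (K : Sym2 (Fin n) → unitInterval) (A N : Finset (Fin n)) (d b : Fin n)
    (hNA : Disjoint N A) (hd : d ∈ A) (ps : List (Fin n × Fin n)) (hps : ∀ p ∈ ps, p.1 ∈ N ∧ p.2 ∈ A)
    (hstep : ∀ i : ℕ, ∀ hi : i < ps.length, (ps[i]).2 ≠ d →
      (prodBernoulli (fun e' : Sym2 (Fin n) =>
          if e' ∈ (ps.take i).map (fun q : Fin n × Fin n => s(q.1, q.2)) then (0 : unitInterval) else K e')).real (openConn d b) ≤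
        (prodBernoulli (fun e' : Sym2 (Fin n) =>
          if e' ∈ (ps.take i).map (fun q : Fin n × Fin n => s(q.1, q.2)) then (0 : unitInterval) else K e')).real
          (openConn (ps[i]).2 b))
    (hbase : (prodBernoulli (fun e' : Sym2 (Fin n) => if (∀ y ∈ e', y ∈ N) ∧ ¬ e'.IsDiag then 1 else
            if e' ∈ ps.map (fun q : Fin n × Fin n => s(q.1, q.2)) then (0 : unitInterval) else K e')).real
          ({ω : Set (Sym2 (Fin n)) | ∃ v ∈ N, ∃ a' ∈ A, s(v, a') ∈ ω} ∩ openConn d b) ≤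
        (prodBernoulli (fun e' : Sym2 (Fin n) => if (∀ y ∈ e', y ∈ N) ∧ ¬ e'.IsDiag then 1 else
            if e' ∈ ps.map (fun q : Fin n × Fin n => s(q.1, q.2)) then (0 : unitInterval) else K e')).real
          ({ω : Set (Sym2 (Fin n)) | ∃ v ∈ N, ∃ a' ∈ A, s(v, a') ∈ ω} ∩ ⋃ v ∈ N, openConn v b)) :
    (prodBernoulli (fun e' : Sym2 (Fin n) => if (∀ y ∈ e', y ∈ N) ∧ ¬ e'.IsDiag then 1 else K e')).real
        ({ω : Set (Sym2 (Fin n)) | ∃ v ∈ N, ∃ a' ∈ A, s(v, a') ∈ ω} ∩ openConn d b) ≤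
      (prodBernoulli (fun e' : Sym2 (Fin n) => if (∀ y ∈ e', y ∈ N) ∧ ¬ e'.IsDiag then 1 else K e')).real
        ({ω : Set (Sym2 (Fin n)) | ∃ v ∈ N, ∃ a' ∈ A, s(v, a') ∈ ω} ∩ ⋃ v ∈ N, openConn v b) := by
  induction ps generalizing K with
  | nil =>
    have hw : (fun e' : Sym2 (Fin n) => if (∀ y ∈ e', y ∈ N) ∧ ¬ e'.IsDiag then 1 else
          if e' ∈ ([] : List (Fin n × Fin n)).map (fun q : Fin n × Fin n => s(q.1, q.2)) then (0 : unitInterval) else K e') =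
        (fun e' : Sym2 (Fin n) => if (∀ y ∈ e', y ∈ N) ∧ ¬ e'.IsDiag then 1 else K e') := by
      funext e
      rw [killPairs_nil_apply K e]
    rw [hw] at hbase
    exact hbase
  | cons p qs ih =>
    obtain ⟨hf, ha⟩ := hps p List.mem_cons_self
    -- the weighting after the first pair
    set K' : Sym2 (Fin n) → unitInterval := fun e' => if e' = s(p.1, p.2) then 0 else K e' with hK'
    have hcons : ∀ (rs : List (Fin n × Fin n)) (e : Sym2 (Fin n)),
        (if e ∈ (p :: rs).map (fun q : Fin n × Fin n => s(q.1, q.2)) then (0 : unitInterval) else K e) =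
          (if e ∈ rs.map (fun q : Fin n × Fin n => s(q.1, q.2)) then (0 : unitInterval) else K' e) :=
      fun rs e => killPairs_cons_apply K p rs e
    -- the conclusion for `K'` from the induction hypothesis
    have hsub : (prodBernoulli (fun e' : Sym2 (Fin n) => if (∀ y ∈ e', y ∈ N) ∧ ¬ e'.IsDiag then 1 else K' e')).real
          ({ω : Set (Sym2 (Fin n)) | ∃ v ∈ N, ∃ a' ∈ A, s(v, a') ∈ ω} ∩ openConn d b) ≤
        (prodBernoulli (fun e' : Sym2 (Fin n) => if (∀ y ∈ e', y ∈ N) ∧ ¬ e'.IsDiag then 1 else K' e')).real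
          ({ω : Set (Sym2 (Fin n)) | ∃ v ∈ N, ∃ a' ∈ A, s(v, a') ∈ ω} ∩ ⋃ v ∈ N, openConn v b) := by
      refine ih K' (fun q hq => hps q (List.mem_cons_of_mem p hq)) ?_ ?_
      · intro i hi hid
        have hi' : i + 1 < (p :: qs).length := by simpa using hi
        have h := hstep (i + 1) hi' (by simpa using hid)
        have hw : (fun e' : Sym2 (Fin n) =>
              if e' ∈ ((p :: qs).take (i + 1)).map (fun q : Fin n × Fin n => s(q.1, q.2)) then (0 : unitInterval) else K e') =
            (fun e' : Sym2 (Fin n) =>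
              if e' ∈ (qs.take i).map (fun q : Fin n × Fin n => s(q.1, q.2)) then (0 : unitInterval) else K' e') := by
          funext e
          rw [List.take_succ_cons]
          exact hcons (qs.take i) e
        have hget : ((p :: qs)[i + 1]).2 = (qs[i]).2 := by simp only [List.getElem_cons_succ]
        rw [hw, hget] at h
        exact h
      · have hw : (fun e' : Sym2 (Fin n) => if (∀ y ∈ e', y ∈ N) ∧ ¬ e'.IsDiag then 1 else
              if e' ∈ (p :: qs).map (fun q : Fin n × Fin n => s(q.1, q.2)) then (0 : unitInterval) else K e') =
            (fun e' : Sym2 (Fin n) => if (∀ y ∈ e', y ∈ N) ∧ ¬ e'.IsDiag then 1 else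
              if e' ∈ qs.map (fun q : Fin n × Fin n => s(q.1, q.2)) then (0 : unitInterval) else K' e') := by
          funext e
          rw [hcons qs e]
        rw [hw] at hbase
        exact hbase
    -- the first step
    by_cases hpd : p.2 = d
    · have hK'd : K' = fun e' : Sym2 (Fin n) => if e' = s(p.1, d) then 0 else K e' := by rw [hK', hpd]
      rw [hK'd] at hsub
      exact fingerML3_peel_pair_self K A N d b p.1 hNA hd hf hsub
    · have h0 := hstep 0 (by simp) (by simpa using hpd)
      have hw0 : (fun e' : Sym2 (Fin n) =>
            if e' ∈ ((p :: qs).take 0).map (fun q : Fin n × Fin n => s(q.1, q.2)) then (0 : unitInterval) else K e') = K := by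
        funext e
        rw [List.take_zero]
        exact killPairs_nil_apply K e
      have hget0 : ((p :: qs)[0]).2 = p.2 := by simp only [List.getElem_cons_zero]
      rw [hw0, hget0] at h0
      exact fingerML3_peel_pair K A N d p.2 b p.1 hNA hd ha (Ne.symm hpd) hf h0 hsub

end FingerPeelList

end

end Summit.CriticalPhenomena.PercolationContinuityZ3.Theorems
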